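import Mathlib
import Summits.NavierStokesRegularity.NavierStokesRegularity.Theorems.PlaneEnergyCeilingSlabEnergyIdentity

/-!
# Route PlaneEnergyCeiling · crux `PlanarEnergyAPriori` · line `birth` — order-(3,2) decay bookkeeping

Helper file toward the registered stub `stub_slabLawMild` (the slab energy law in mild form) of
the crux item stmt-NavierStokesRegularity-16855 (`PlanarEnergyAPriori`), landed `--supports` that
item.

Bookkeeping for fields with ORDER-(3,2) DECAY — a `C²` field `u : ℝ³ → ℝ³` and a `C¹` scalar
`p` with `‖u‖, ‖Du‖, ‖D²u‖ ≤ C (1+‖x‖)⁻³` and `|p|, ‖Dp‖ ≤ C (1+‖x‖)⁻²` (the decay persisted along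
classical Leray–Hopf solutions from rapidly decaying data, stub `stub_decayPersistence`, with the
pressure constant subtracted):

* weights of the height `x ↦ g(x₂)` (chain rule, coordinate derivatives `∂ⱼ[g(x₂)] = [j=2] g'(x₂)`);
* integrability on `ℝ³` from a bound `‖f‖ ≤ C(1+‖x‖)⁻ʳ`, `r > 3` (Mathlib `integrable_one_add_norm`),
  and of products with bounded weights of the height;
* pointwise weighted bounds on the energy densities `‖u‖²`, `⟪u, ∂ⱼu⟫`, `∂ⱼ⟪u, ∂ⱼu⟫`, `‖∂ⱼu‖²`,
  `(‖u‖²/2 + p)uⱼ`, `∂ⱼ((‖u‖²/2 + p)uⱼ)` (exponents `6, 6, 6, 6, 5, 5`), hence their integrability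
  (`decayDensitiesIntegrable`).

These feed the weighted energy identity and the Gaussian-weighted Duhamel argument for the mild
slab law. Folklore calculus; the densities and their derivatives are those of
`Theorems/PlaneEnergyCeilingSlabEnergyIdentityPointwise.lean` (Caffarelli–Kohn–Nirenberg 1982 §2).
-/

noncomputable section

-- single-conjunct summit: `Summit.<Summit>.<Problem>` repeats the name by the D-0017 layout
set_option linter.dupNamespace false

namespace Summit.NavierStokesRegularity.NavierStokesRegularity.Theorems.PlanarEnergyAPriori.SlabLaw

open MeasureTheory Set Filter Topology WithLp
open scoped RealInnerProductSpace
open Literature.Analysis.FluidPDE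
open Summit.NavierStokesRegularity.NavierStokesRegularity.Theorems.PlaneEnergyCeilingSlabEnergyIdentity

/-! ### Weights depending on the height `x₂` only -/

/-- The height coordinate `x ↦ x₂` is the continuous linear map `proj 2`. -/
theorem hasFDerivAt_coord_two (x : EuclideanSpace ℝ (Fin 3)) :
    HasFDerivAt (fun x : EuclideanSpace ℝ (Fin 3) => x 2)
      (EuclideanSpace.proj (2 : Fin 3) : EuclideanSpace ℝ (Fin 3) →L[ℝ] ℝ) x :=
  (EuclideanSpace.proj (2 : Fin 3) : EuclideanSpace ℝ (Fin 3) →L[ℝ] ℝ).hasFDerivAt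

/-- Chain rule for a weight of the height: `D[g(x₂)] = g'(x₂) • proj 2`. -/
theorem hasFDerivAt_weight {g : ℝ → ℝ} {g' : ℝ} {x : EuclideanSpace ℝ (Fin 3)} (hg : HasDerivAt g g' (x 2)) :
    HasFDerivAt (fun x : EuclideanSpace ℝ (Fin 3) => g (x 2))
      (g' • (EuclideanSpace.proj (2 : Fin 3) : EuclideanSpace ℝ (Fin 3) →L[ℝ] ℝ)) x :=
  hg.comp_hasFDerivAt x (hasFDerivAt_coord_two x)

/-- A differentiable weight of the height is differentiable on `ℝ³`. -/
theorem differentiable_weight {g : ℝ → ℝ} (hg : Differentiable ℝ g) :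
    Differentiable ℝ (fun x : EuclideanSpace ℝ (Fin 3) => g (x 2)) := fun x =>
  (hasFDerivAt_weight (hg (x 2)).hasDerivAt).differentiableAt

/-- The coordinate derivatives of a weight of the height: `∂ⱼ[g(x₂)] = g'(x₂)` for `j = 2` and `0`
for the in-plane directions. -/
theorem fderiv_weight_apply_single {g : ℝ → ℝ} (hg : Differentiable ℝ g) (x : EuclideanSpace ℝ (Fin 3)) (j : Fin 3) :
    fderiv ℝ (fun x : EuclideanSpace ℝ (Fin 3) => g (x 2)) x (EuclideanSpace.single j 1) =
      if j = 2 then deriv g (x 2) else 0 := by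
  rw [(hasFDerivAt_weight (hg _).hasDerivAt).fderiv]
  fin_cases j <;> simp

/-- A continuous weight of the height is continuous on `ℝ³`. -/
theorem continuous_weight {g : ℝ → ℝ} (hg : Continuous g) :
    Continuous (fun x : EuclideanSpace ℝ (Fin 3) => g (x 2)) :=
  hg.comp (EuclideanSpace.proj (2 : Fin 3) : EuclideanSpace ℝ (Fin 3) →L[ℝ] ℝ).continuous

/-! ### Integrability from polynomial decay -/

section Decay

variable {F : Type*} [NormedAddCommGroup F]

/-- A continuous `f` on `ℝ³` with `‖f x‖ ≤ C (1 + ‖x‖)⁻ʳ`, `r > 3`, is integrable (Mathlib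
`integrable_one_add_norm`). -/
theorem integrable_of_norm_le_rpow {f : EuclideanSpace ℝ (Fin 3) → F} (hf : Continuous f) {C r : ℝ} (hr : 3 < r)
    (h : ∀ x, ‖f x‖ ≤ C * (1 + ‖x‖) ^ (-r)) : Integrable f := by
  have hr' : (Module.finrank ℝ (EuclideanSpace ℝ (Fin 3)) : ℝ) < r := by
    rw [finrank_euclideanSpace, Fintype.card_fin]; exact_mod_cast hr
  exact Integrable.mono' ((integrable_one_add_norm hr').const_mul C) hf.aestronglyMeasurable
    (Eventually.of_forall h)

/-- A bounded continuous weight of the height times an integrable function is integrable. -/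
theorem integrable_weight_mul {f : EuclideanSpace ℝ (Fin 3) → ℝ} (hf : Integrable f) {w : ℝ → ℝ} (hw : Continuous w)
    {K : ℝ} (hK : ∀ z, |w z| ≤ K) : Integrable (fun x : EuclideanSpace ℝ (Fin 3) => w (x 2) * f x) :=
  hf.bdd_mul (continuous_weight hw).aestronglyMeasurable
    (Eventually.of_forall fun x => by simpa using hK (x 2))

/-- Monotonicity of the weights in the exponent: `(1+‖x‖)⁻ʳ ≤ (1+‖x‖)⁻ˢ` for `s ≤ r`. -/
theorem rpow_neg_le_rpow_neg_of_le (x : EuclideanSpace ℝ (Fin 3)) {r s : ℝ} (hsr : s ≤ r) :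
    (1 + ‖x‖) ^ (-r) ≤ (1 + ‖x‖) ^ (-s) :=
  Real.rpow_le_rpow_of_exponent_le (by simp) (by linarith)

/-- The weights are at most one: `(1+‖x‖)⁻ʳ ≤ 1` for `r ≥ 0`. -/
theorem rpow_neg_le_one (x : EuclideanSpace ℝ (Fin 3)) {r : ℝ} (hr : 0 ≤ r) : (1 + ‖x‖) ^ (-r) ≤ 1 :=
  Real.rpow_le_one_of_one_le_of_nonpos (by simp) (by linarith)

/-- The weights are positive. -/
theorem rpow_neg_pos (x : EuclideanSpace ℝ (Fin 3)) (r : ℝ) : 0 < (1 + ‖x‖) ^ (-r) :=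
  Real.rpow_pos_of_pos (by positivity) _

/-- Products of weights add exponents: `(1+‖x‖)⁻ʳ (1+‖x‖)⁻ˢ = (1+‖x‖)⁻⁽ʳ⁺ˢ⁾`. -/
theorem rpow_neg_mul_rpow_neg (x : EuclideanSpace ℝ (Fin 3)) (r s : ℝ) :
    (1 + ‖x‖) ^ (-r) * (1 + ‖x‖) ^ (-s) = (1 + ‖x‖) ^ (-(r + s)) := by
  rw [← Real.rpow_add (by positivity)]; ring_nf

/-- A constant dominating a norm through a positive weight is nonnegative. -/
theorem nonneg_of_norm_le_rpow {X : Type*} [NormedAddCommGroup X] {f : EuclideanSpace ℝ (Fin 3) → X} {C r : ℝ}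
    (h : ∀ x, ‖f x‖ ≤ C * (1 + ‖x‖) ^ (-r)) : 0 ≤ C := by
  have h0 := h 0
  have hw := rpow_neg_pos (0 : EuclideanSpace ℝ (Fin 3)) r
  nlinarith [norm_nonneg (f 0)]

/-- `(1+‖x‖)⁻³ · (1+‖x‖)⁻³ = (1+‖x‖)⁻⁶`. -/
theorem weight_three_mul_three (x : EuclideanSpace ℝ (Fin 3)) :
    (1 + ‖x‖) ^ (-(3 : ℝ)) * (1 + ‖x‖) ^ (-(3 : ℝ)) = (1 + ‖x‖) ^ (-(6 : ℝ)) := by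
  rw [rpow_neg_mul_rpow_neg]; norm_num

/-- `(1+‖x‖)⁻² · (1+‖x‖)⁻³ = (1+‖x‖)⁻⁵`. -/
theorem weight_two_mul_three (x : EuclideanSpace ℝ (Fin 3)) :
    (1 + ‖x‖) ^ (-(2 : ℝ)) * (1 + ‖x‖) ^ (-(3 : ℝ)) = (1 + ‖x‖) ^ (-(5 : ℝ)) := by
  rw [rpow_neg_mul_rpow_neg]; norm_num

end Decay

/-! ### Pointwise bounds on the densities under order-(3,2) decay -/

section Bounds

variable {u : EuclideanSpace ℝ (Fin 3) → EuclideanSpace ℝ (Fin 3)} {p : EuclideanSpace ℝ (Fin 3) → ℝ} {C : ℝ}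
  {x : EuclideanSpace ℝ (Fin 3)}

/-- `‖u‖² ≤ C² (1+‖x‖)⁻⁶`. -/
theorem norm_sq_le_weight (h0 : ‖u x‖ ≤ C * (1 + ‖x‖) ^ (-(3 : ℝ))) :
    ‖u x‖ ^ 2 ≤ C ^ 2 * (1 + ‖x‖) ^ (-(6 : ℝ)) := by
  calc ‖u x‖ ^ 2 ≤ (C * (1 + ‖x‖) ^ (-(3 : ℝ))) ^ 2 := pow_le_pow_left₀ (norm_nonneg _) h0 2
    _ = C ^ 2 * (1 + ‖x‖) ^ (-(6 : ℝ)) := by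
        rw [mul_pow, sq ((1 + ‖x‖) ^ (-(3 : ℝ))), weight_three_mul_three]

/-- `|⟪u, ∂ⱼu⟫| ≤ C² (1+‖x‖)⁻⁶`. -/
theorem norm_inner_fderiv_le_weight (hC : 0 ≤ C) (h0 : ‖u x‖ ≤ C * (1 + ‖x‖) ^ (-(3 : ℝ)))
    (h1 : ‖fderiv ℝ u x‖ ≤ C * (1 + ‖x‖) ^ (-(3 : ℝ))) (j : Fin 3) :
    ‖⟪u x, fderiv ℝ u x (EuclideanSpace.single j 1)⟫‖ ≤ C ^ 2 * (1 + ‖x‖) ^ (-(6 : ℝ)) := by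
  have hj : ‖fderiv ℝ u x (EuclideanSpace.single j 1)‖ ≤ C * (1 + ‖x‖) ^ (-(3 : ℝ)) :=
    (norm_fderiv_single_le u x j).trans h1
  calc _ ≤ ‖u x‖ * ‖fderiv ℝ u x (EuclideanSpace.single j 1)‖ := norm_inner_le_norm _ _
    _ ≤ (C * (1 + ‖x‖) ^ (-(3 : ℝ))) * (C * (1 + ‖x‖) ^ (-(3 : ℝ))) :=
        mul_le_mul h0 hj (norm_nonneg _) (mul_nonneg hC (rpow_neg_pos x 3).le)
    _ = C ^ 2 * (1 + ‖x‖) ^ (-(6 : ℝ)) := by rw [← weight_three_mul_three]; ring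

/-- `‖∂ⱼu‖² ≤ C² (1+‖x‖)⁻⁶`. -/
theorem norm_sq_fderiv_le_weight (h1 : ‖fderiv ℝ u x‖ ≤ C * (1 + ‖x‖) ^ (-(3 : ℝ))) (j : Fin 3) :
    ‖fderiv ℝ u x (EuclideanSpace.single j 1)‖ ^ 2 ≤ C ^ 2 * (1 + ‖x‖) ^ (-(6 : ℝ)) := by
  have hj := (norm_fderiv_single_le u x j).trans h1
  calc _ ≤ (C * (1 + ‖x‖) ^ (-(3 : ℝ))) ^ 2 := pow_le_pow_left₀ (norm_nonneg _) hj 2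
    _ = _ := by rw [mul_pow, sq ((1 + ‖x‖) ^ (-(3 : ℝ))), weight_three_mul_three]

/-- `|‖∂ⱼu‖² + ⟪u, D²u(eⱼ,eⱼ)⟫| ≤ 2C² (1+‖x‖)⁻⁶`. -/
theorem norm_fderiv_inner_fderiv_le_weight (hC : 0 ≤ C) (h0 : ‖u x‖ ≤ C * (1 + ‖x‖) ^ (-(3 : ℝ)))
    (h1 : ‖fderiv ℝ u x‖ ≤ C * (1 + ‖x‖) ^ (-(3 : ℝ)))
    (h2 : ‖iteratedFDeriv ℝ 2 u x‖ ≤ C * (1 + ‖x‖) ^ (-(3 : ℝ))) (j : Fin 3) :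
    ‖‖fderiv ℝ u x (EuclideanSpace.single j 1)‖ ^ 2 +
        ⟪u x, iteratedFDeriv ℝ 2 u x ![EuclideanSpace.single j 1, EuclideanSpace.single j 1]⟫‖ ≤
      2 * C ^ 2 * (1 + ‖x‖) ^ (-(6 : ℝ)) := by
  have hA := norm_sq_fderiv_le_weight h1 j
  have hB : ‖⟪u x, iteratedFDeriv ℝ 2 u x ![EuclideanSpace.single j 1, EuclideanSpace.single j 1]⟫‖ ≤
      C ^ 2 * (1 + ‖x‖) ^ (-(6 : ℝ)) := by
    calc _ ≤ ‖u x‖ * ‖iteratedFDeriv ℝ 2 u x ![EuclideanSpace.single j 1, EuclideanSpace.single j 1]‖ :=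
          norm_inner_le_norm _ _
      _ ≤ (C * (1 + ‖x‖) ^ (-(3 : ℝ))) * (C * (1 + ‖x‖) ^ (-(3 : ℝ))) :=
          mul_le_mul h0 ((norm_iteratedFDeriv_two_single_le u x j).trans h2) (norm_nonneg _)
            (mul_nonneg hC (rpow_neg_pos x 3).le)
      _ = C ^ 2 * (1 + ‖x‖) ^ (-(6 : ℝ)) := by rw [← weight_three_mul_three]; ring
  calc _ ≤ ‖‖fderiv ℝ u x (EuclideanSpace.single j 1)‖ ^ 2‖ +
        ‖⟪u x, iteratedFDeriv ℝ 2 u x ![EuclideanSpace.single j 1, EuclideanSpace.single j 1]⟫‖ :=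
        norm_add_le _ _
    _ ≤ C ^ 2 * (1 + ‖x‖) ^ (-(6 : ℝ)) + C ^ 2 * (1 + ‖x‖) ^ (-(6 : ℝ)) := by
        gcongr
        rwa [Real.norm_of_nonneg (sq_nonneg _)]
    _ = 2 * C ^ 2 * (1 + ‖x‖) ^ (-(6 : ℝ)) := by ring

/-- `|‖u‖²/2 + p| ≤ (C²/2 + C) (1+‖x‖)⁻²`. -/
theorem norm_bernoulli_le_weight (h0 : ‖u x‖ ≤ C * (1 + ‖x‖) ^ (-(3 : ℝ)))
    (k0 : ‖p x‖ ≤ C * (1 + ‖x‖) ^ (-(2 : ℝ))) :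
    ‖‖u x‖ ^ 2 / 2 + p x‖ ≤ (C ^ 2 / 2 + C) * (1 + ‖x‖) ^ (-(2 : ℝ)) := by
  have h62 : (1 + ‖x‖) ^ (-(6 : ℝ)) ≤ (1 + ‖x‖) ^ (-(2 : ℝ)) := rpow_neg_le_rpow_neg_of_le x (by norm_num)
  have hsq : ‖u x‖ ^ 2 ≤ C ^ 2 * (1 + ‖x‖) ^ (-(2 : ℝ)) :=
    (norm_sq_le_weight h0).trans (mul_le_mul_of_nonneg_left h62 (sq_nonneg C))
  calc _ ≤ ‖‖u x‖ ^ 2 / 2‖ + ‖p x‖ := norm_add_le _ _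
    _ = ‖u x‖ ^ 2 / 2 + ‖p x‖ := by rw [Real.norm_of_nonneg (by positivity)]
    _ ≤ C ^ 2 * (1 + ‖x‖) ^ (-(2 : ℝ)) / 2 + C * (1 + ‖x‖) ^ (-(2 : ℝ)) := by gcongr
    _ = _ := by ring

/-- `|(‖u‖²/2 + p) uⱼ| ≤ (C³/2 + C²) (1+‖x‖)⁻⁵`. -/
theorem norm_bernoulli_mul_le_weight (hC : 0 ≤ C) (h0 : ‖u x‖ ≤ C * (1 + ‖x‖) ^ (-(3 : ℝ)))
    (k0 : ‖p x‖ ≤ C * (1 + ‖x‖) ^ (-(2 : ℝ))) (j : Fin 3) :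
    ‖(‖u x‖ ^ 2 / 2 + p x) * u x j‖ ≤ (C ^ 3 / 2 + C ^ 2) * (1 + ‖x‖) ^ (-(5 : ℝ)) := by
  have hθ := norm_bernoulli_le_weight h0 k0
  have huj : ‖u x j‖ ≤ C * (1 + ‖x‖) ^ (-(3 : ℝ)) := (norm_apply_le_norm (u x) j).trans h0
  rw [norm_mul]
  calc _ ≤ ((C ^ 2 / 2 + C) * (1 + ‖x‖) ^ (-(2 : ℝ))) * (C * (1 + ‖x‖) ^ (-(3 : ℝ))) :=
        mul_le_mul hθ huj (norm_nonneg _)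
          (mul_nonneg (add_nonneg (by positivity) hC) (rpow_neg_pos x 2).le)
    _ = (C ^ 3 / 2 + C ^ 2) * (1 + ‖x‖) ^ (-(5 : ℝ)) := by rw [← weight_two_mul_three]; ring

/-- `|∂ⱼ((‖u‖²/2 + p) uⱼ)| = |(⟪u, ∂ⱼu⟫ + ∂ⱼp) uⱼ + (‖u‖²/2 + p)(∂ⱼu)ⱼ| ≤ (3C³/2 + 2C²)(1+‖x‖)⁻⁵`. -/
theorem norm_fderiv_bernoulli_mul_le_weight (hC : 0 ≤ C) (h0 : ‖u x‖ ≤ C * (1 + ‖x‖) ^ (-(3 : ℝ)))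
    (h1 : ‖fderiv ℝ u x‖ ≤ C * (1 + ‖x‖) ^ (-(3 : ℝ))) (k0 : ‖p x‖ ≤ C * (1 + ‖x‖) ^ (-(2 : ℝ)))
    (k1 : ‖fderiv ℝ p x‖ ≤ C * (1 + ‖x‖) ^ (-(2 : ℝ))) (j : Fin 3) :
    ‖(⟪u x, fderiv ℝ u x (EuclideanSpace.single j 1)⟫ + fderiv ℝ p x (EuclideanSpace.single j 1)) *
          u x j + (‖u x‖ ^ 2 / 2 + p x) * fderiv ℝ u x (EuclideanSpace.single j 1) j‖ ≤
      (3 * C ^ 3 / 2 + 2 * C ^ 2) * (1 + ‖x‖) ^ (-(5 : ℝ)) := by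
  have h62 : (1 + ‖x‖) ^ (-(6 : ℝ)) ≤ (1 + ‖x‖) ^ (-(2 : ℝ)) := rpow_neg_le_rpow_neg_of_le x (by norm_num)
  have hin : ‖⟪u x, fderiv ℝ u x (EuclideanSpace.single j 1)⟫‖ ≤ C ^ 2 * (1 + ‖x‖) ^ (-(2 : ℝ)) :=
    (norm_inner_fderiv_le_weight hC h0 h1 j).trans (mul_le_mul_of_nonneg_left h62 (sq_nonneg C))
  have hDp : ‖fderiv ℝ p x (EuclideanSpace.single j 1)‖ ≤ C * (1 + ‖x‖) ^ (-(2 : ℝ)) := by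
    refine ((ContinuousLinearMap.le_opNorm _ _).trans ?_).trans k1
    simp
  have hA : ‖⟪u x, fderiv ℝ u x (EuclideanSpace.single j 1)⟫ +
      fderiv ℝ p x (EuclideanSpace.single j 1)‖ ≤ (C ^ 2 + C) * (1 + ‖x‖) ^ (-(2 : ℝ)) := by
    calc _ ≤ ‖⟪u x, fderiv ℝ u x (EuclideanSpace.single j 1)⟫‖ +
          ‖fderiv ℝ p x (EuclideanSpace.single j 1)‖ := norm_add_le _ _
      _ ≤ C ^ 2 * (1 + ‖x‖) ^ (-(2 : ℝ)) + C * (1 + ‖x‖) ^ (-(2 : ℝ)) := add_le_add hin hDp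
      _ = _ := by ring
  have huj : ‖u x j‖ ≤ C * (1 + ‖x‖) ^ (-(3 : ℝ)) := (norm_apply_le_norm (u x) j).trans h0
  have hDuj : ‖fderiv ℝ u x (EuclideanSpace.single j 1) j‖ ≤ C * (1 + ‖x‖) ^ (-(3 : ℝ)) :=
    (norm_apply_le_norm _ j).trans ((norm_fderiv_single_le u x j).trans h1)
  have hθ := norm_bernoulli_le_weight h0 k0
  have hw2 : 0 ≤ (1 + ‖x‖) ^ (-(2 : ℝ)) := (rpow_neg_pos x 2).le
  calc _ ≤ ‖(⟪u x, fderiv ℝ u x (EuclideanSpace.single j 1)⟫ +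
          fderiv ℝ p x (EuclideanSpace.single j 1)) * u x j‖ +
        ‖(‖u x‖ ^ 2 / 2 + p x) * fderiv ℝ u x (EuclideanSpace.single j 1) j‖ := norm_add_le _ _
    _ = ‖⟪u x, fderiv ℝ u x (EuclideanSpace.single j 1)⟫ +
          fderiv ℝ p x (EuclideanSpace.single j 1)‖ * ‖u x j‖ +
        ‖‖u x‖ ^ 2 / 2 + p x‖ * ‖fderiv ℝ u x (EuclideanSpace.single j 1) j‖ := by
        rw [norm_mul, norm_mul]
    _ ≤ ((C ^ 2 + C) * (1 + ‖x‖) ^ (-(2 : ℝ))) * (C * (1 + ‖x‖) ^ (-(3 : ℝ))) +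
        ((C ^ 2 / 2 + C) * (1 + ‖x‖) ^ (-(2 : ℝ))) * (C * (1 + ‖x‖) ^ (-(3 : ℝ))) :=
        add_le_add
          (mul_le_mul hA huj (norm_nonneg _) (mul_nonneg (add_nonneg (sq_nonneg C) hC) hw2))
          (mul_le_mul hθ hDuj (norm_nonneg _) (mul_nonneg (add_nonneg (by positivity) hC) hw2))
    _ = (3 * C ^ 3 / 2 + 2 * C ^ 2) * (1 + ‖x‖) ^ (-(5 : ℝ)) := by rw [← weight_two_mul_three]; ring

end Bounds

/-! ### Integrability of the densities -/

section Integrability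

variable {u : EuclideanSpace ℝ (Fin 3) → EuclideanSpace ℝ (Fin 3)} {p : EuclideanSpace ℝ (Fin 3) → ℝ} {C : ℝ}

/-- `‖u‖²` is integrable on `ℝ³`. -/
theorem integrable_norm_sq (hu : Continuous u) (h0 : ∀ x, ‖u x‖ ≤ C * (1 + ‖x‖) ^ (-(3 : ℝ))) :
    Integrable fun x => ‖u x‖ ^ 2 :=
  integrable_of_norm_le_rpow (hu.norm.pow 2) (by norm_num : (3 : ℝ) < 6) fun x => by
    rw [Real.norm_of_nonneg (sq_nonneg _)]; exact norm_sq_le_weight (h0 x)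

/-- `⟪u, ∂ⱼu⟫` is integrable on `ℝ³`. -/
theorem integrable_inner_fderiv' (hu : ContDiff ℝ 2 u) (h0 : ∀ x, ‖u x‖ ≤ C * (1 + ‖x‖) ^ (-(3 : ℝ)))
    (h1 : ∀ x, ‖fderiv ℝ u x‖ ≤ C * (1 + ‖x‖) ^ (-(3 : ℝ))) (j : Fin 3) :
    Integrable fun z => ⟪u z, fderiv ℝ u z (EuclideanSpace.single j 1)⟫ :=
  integrable_of_norm_le_rpow (contDiff_inner_fderiv hu j).continuous (by norm_num : (3 : ℝ) < 6)
    fun x => norm_inner_fderiv_le_weight (nonneg_of_norm_le_rpow h0) (h0 x) (h1 x) j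

/-- `∂ⱼ⟪u, ∂ⱼu⟫` is integrable on `ℝ³`. -/
theorem integrable_fderiv_inner_fderiv' (hu : ContDiff ℝ 2 u) (h0 : ∀ x, ‖u x‖ ≤ C * (1 + ‖x‖) ^ (-(3 : ℝ)))
    (h1 : ∀ x, ‖fderiv ℝ u x‖ ≤ C * (1 + ‖x‖) ^ (-(3 : ℝ)))
    (h2 : ∀ x, ‖iteratedFDeriv ℝ 2 u x‖ ≤ C * (1 + ‖x‖) ^ (-(3 : ℝ))) (j : Fin 3) :
    Integrable fun x => fderiv ℝ (fun z => ⟪u z, fderiv ℝ u z (EuclideanSpace.single j 1)⟫) x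
      (EuclideanSpace.single j 1) := by
  refine integrable_of_norm_le_rpow (C := 2 * C ^ 2)
    (((contDiff_inner_fderiv hu j).continuous_fderiv one_ne_zero).clm_apply continuous_const)
    (by norm_num : (3 : ℝ) < 6) fun x => ?_
  rw [fderiv_inner_fderiv_apply hu]
  exact norm_fderiv_inner_fderiv_le_weight (nonneg_of_norm_le_rpow h0) (h0 x) (h1 x) (h2 x) j

/-- The dissipation density `‖∂ⱼu‖²` is integrable on `ℝ³`. -/
theorem integrable_norm_sq_fderiv' (hu : ContDiff ℝ 1 u) (h1 : ∀ x, ‖fderiv ℝ u x‖ ≤ C * (1 + ‖x‖) ^ (-(3 : ℝ)))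
    (j : Fin 3) : Integrable fun x => ‖fderiv ℝ u x (EuclideanSpace.single j 1)‖ ^ 2 :=
  integrable_of_norm_le_rpow (((hu.continuous_fderiv one_ne_zero).clm_apply continuous_const).norm.pow 2)
    (by norm_num : (3 : ℝ) < 6) fun x => by
    rw [Real.norm_of_nonneg (sq_nonneg _)]; exact norm_sq_fderiv_le_weight (h1 x) j

/-- The Bernoulli flux density `(‖u‖²/2 + p) uⱼ` is integrable on `ℝ³`. -/
theorem integrable_bernoulli_mul' (hu : ContDiff ℝ 1 u) (hp : ContDiff ℝ 1 p)
    (h0 : ∀ x, ‖u x‖ ≤ C * (1 + ‖x‖) ^ (-(3 : ℝ))) (k0 : ∀ x, ‖p x‖ ≤ C * (1 + ‖x‖) ^ (-(2 : ℝ)))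
    (j : Fin 3) : Integrable fun z => (‖u z‖ ^ 2 / 2 + p z) * u z j :=
  integrable_of_norm_le_rpow (contDiff_bernoulli_mul hu hp j).continuous (by norm_num : (3 : ℝ) < 5)
    fun x => norm_bernoulli_mul_le_weight (nonneg_of_norm_le_rpow h0) (h0 x) (k0 x) j

/-- `∂ⱼ((‖u‖²/2 + p) uⱼ)` is integrable on `ℝ³`. -/
theorem integrable_fderiv_bernoulli_mul' (hu : ContDiff ℝ 1 u) (hp : ContDiff ℝ 1 p)
    (h0 : ∀ x, ‖u x‖ ≤ C * (1 + ‖x‖) ^ (-(3 : ℝ))) (h1 : ∀ x, ‖fderiv ℝ u x‖ ≤ C * (1 + ‖x‖) ^ (-(3 : ℝ)))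
    (k0 : ∀ x, ‖p x‖ ≤ C * (1 + ‖x‖) ^ (-(2 : ℝ))) (k1 : ∀ x, ‖fderiv ℝ p x‖ ≤ C * (1 + ‖x‖) ^ (-(2 : ℝ)))
    (j : Fin 3) :
    Integrable fun x => fderiv ℝ (fun z => (‖u z‖ ^ 2 / 2 + p z) * u z j) x (EuclideanSpace.single j 1) := by
  refine integrable_of_norm_le_rpow (C := 3 * C ^ 3 / 2 + 2 * C ^ 2)
    (((contDiff_bernoulli_mul hu hp j).continuous_fderiv one_ne_zero).clm_apply continuous_const)
    (by norm_num : (3 : ℝ) < 5) fun x => ?_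
  rw [fderiv_bernoulli_mul_apply (hu.differentiable one_ne_zero) (hp.differentiable one_ne_zero)]
  exact norm_fderiv_bernoulli_mul_le_weight (nonneg_of_norm_le_rpow h0) (h0 x) (h1 x) (k0 x) (k1 x) j

end Integrability

/-- **Integrability of the energy densities under order-(3,2) decay** (closed form, all binders
explicit; registered on the crux item as a helper stub toward `stub_slabLawMild`): for `C²` `u` and
`C¹` `p` with `‖u‖, ‖Du‖, ‖D²u‖ ≤ C(1+‖x‖)⁻³`, `|p|, ‖Dp‖ ≤ C(1+‖x‖)⁻²`, the densities `‖u‖²`,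
`⟪u, ∂ⱼu⟫`, `∂ⱼ⟪u, ∂ⱼu⟫`, `‖∂ⱼu‖²`, `(‖u‖²/2 + p)uⱼ` and `∂ⱼ((‖u‖²/2 + p)uⱼ)` are integrable on `ℝ³`. -/
theorem decayDensitiesIntegrable : ∀ (u : EuclideanSpace ℝ (Fin 3) → EuclideanSpace ℝ (Fin 3)) (p : EuclideanSpace ℝ (Fin 3) → ℝ) (C : ℝ), ContDiff ℝ 2 u → ContDiff ℝ 1 p → (∀ x, ‖u x‖ ≤ C * (1 + ‖x‖) ^ (-(3 : ℝ))) → (∀ x, ‖fderiv ℝ u x‖ ≤ C * (1 + ‖x‖) ^ (-(3 : ℝ))) → (∀ x, ‖iteratedFDeriv ℝ 2 u x‖ ≤ C * (1 + ‖x‖) ^ (-(3 : ℝ))) → (∀ x, ‖p x‖ ≤ C * (1 + ‖x‖) ^ (-(2 : ℝ))) → (∀ x, ‖fderiv ℝ p x‖ ≤ C * (1 + ‖x‖) ^ (-(2 : ℝ))) → ∀ j : Fin 3, MeasureTheory.Integrable (fun x => ‖u x‖ ^ 2) ∧ MeasureTheory.Integrable (fun z => inner ℝ (u z) (fderiv ℝ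 u z (EuclideanSpace.single j 1))) ∧ MeasureTheory.Integrable (fun x => fderiv ℝ (fun z => inner ℝ (u z) (fderiv ℝ u z (EuclideanSpace.single j 1))) x (EuclideanSpace.single j 1)) ∧ MeasureTheory.Integrable (fun x => ‖fderiv ℝ u x (EuclideanSpace.single j 1)‖ ^ 2) ∧ MeasureTheory.Integrable (fun z => (‖u z‖ ^ 2 / 2 + p z) * u z j) ∧ MeasureTheory.Integrable (fun x => fderiv ℝ (fun z => (‖u z‖ ^ 2 / 2 + p z) * u z j) x (EuclideanSpace.single j 1)) :=
  fun _u _p _C hu hp h0 h1 h2 k0 k1 j =>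
    ⟨integrable_norm_sq hu.continuous h0, integrable_inner_fderiv' hu h0 h1 j,
      integrable_fderiv_inner_fderiv' hu h0 h1 h2 j, integrable_norm_sq_fderiv' (hu.of_le one_le_two) h1 j,
      integrable_bernoulli_mul' (hu.of_le one_le_two) hp h0 k0 j,
      integrable_fderiv_bernoulli_mul' (hu.of_le one_le_two) hp h0 h1 k0 k1 j⟩

end Summit.NavierStokesRegularity.NavierStokesRegularity.Theorems.PlanarEnergyAPriori.SlabLaw

end
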